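import Literature.NumberTheory.Sieve.Polymath8aSmoothSiegelWalfisz
import Literature.NumberTheory.Sieve.DivisorPowerSums
import HarnessLib

/-!
# Polymath 8a, Lemma 3.4 (ii)–(iii): a smooth sequence at scale `N ≫ x^ε` has the Siegel–Walfisz property

Support file for the named fact `Literature.NumberTheory.Sieve.mpz_of_lt` (**parity.S29**,
`ParityWave0.lean`): D. H. J. Polymath, *New equidistribution estimates of Zhang type*, Algebra &
Number Theory 8:9 (2014) 2067–2199 = arXiv:1402.0811.  Lemma 3.4 (iii) of the proof of Lemma 2.7:
"If `N_k ≫ x^ε` for some fixed `ε > 0`, then `α_k` satisfies the Siegel–Walfisz property … For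
`k > j`, `α_k` is smooth, and the Siegel–Walfisz property for `α_k` follows from the Poisson
summation formula".  The uniform inequality behind this (`abs_apDiscrepancy_coprime_smooth_le`,
`Polymath8aSmoothSiegelWalfisz.lean`) bounds `Δ(α 1_{(·,r)=1}; a (q))` by `(q/6) ∫|g''| ∑_{d∣r, d≤X} d`;
this file turns it into the Siegel–Walfisz shape of Definition 2.5 (ii),
`≤ C_A τ(qr) N (log x)^{-A}` for ALL `q, r ≥ 1`, by combining it with the trivial bound in the
range `q (log x)^{A⁺+B₂} > N` and paying for powers of `log x` with `x^ε ≤ N`: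

* `card_filter_natCast_eq_le` — a residue class meets `[u, v]` in at most `(v − u)/q + 1` naturals;
* `exists_log_rpow_le_rpow'` (`(log x)^E ≤ G x^ε`), `rpow_le_two_rpow_mul_rpow`
  (`L^a ≤ 2^{b−a} L^b` for `L ≥ 1/2`) — growth bookkeeping;
* `iteratedDeriv_ofReal_comp`, `iteratedDeriv_eq_zero_of_not_mem`,
  `integral_norm_iteratedDeriv_two_scaled_le` — `∫ |(ψ(·/N))''| ≤ N⁻¹ (C − c) sup|ψ''|` for `ψ`
  smooth supported in `[c, C]`;
* `exists_siegelWalfisz_const_of_smooth` — **the theorem**: for `0 < c ≤ C`, size data for `ψ` and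
  `ψ''`, `ε > 0` and `A`, there is `Csw ≥ 0` with
  `|Δ(α 1_{(·,r)=1}; a (q))| ≤ Csw τ(qr) N (log x)^{-A}` for all `x ≥ 2`, `x^ε ≤ N`, `cN ≥ 1`,
  `ψ ∈ C^∞` supported in `[c, C]` with `|ψ| ≤ K₀ (log x)^{B₀}`, `|ψ''| ≤ K₂ (log x)^{B₂}`,
  `α(n) = ψ(n/N)`, `q, r ≥ 1`, `a (q)` primitive (window `[1, ⌊CN⌋ + 1]`).

In the vocabulary of `Polymath8aCoefficientSequences.lean` this is
`IsSmoothAtScale ⟹ HasSiegelWalfisz` for `N ≥ x^ε` (only the bounds on `ψ` and `ψ''` are used).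
Nothing here discharges `mpz_of_lt`.

## References

* D. H. J. Polymath, *New equidistribution estimates of Zhang type*, Algebra & Number Theory 8:9
  (2014), 2067–2199, arXiv:1402.0811: Definition 2.5 (ii), (iii); Lemma 3.4 (ii), (iii) and proof
  (§3). [cite: Polymath8a2014]
-/

open Finset MeasureTheory
open scoped ArithmeticFunction.sigma ContDiff

namespace Literature.NumberTheory.Sieve

namespace Polymath8a

/-- Counting a residue class in an interval: the naturals `n ≡ a (q)` with `u ≤ n ≤ v` number at
most `(v − u)/q + 1` (`q ≥ 1`; two distinct members differ by at least `q`). [folklore] -/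
theorem card_filter_natCast_eq_le {q : ℕ} (hq : 0 < q) (a : ZMod q) (s : Finset ℕ) {u v : ℝ}
    (huv : u ≤ v) (hs : ∀ n ∈ s, ((n : ℕ) : ZMod q) = a → u ≤ n ∧ (n : ℝ) ≤ v) :
    ((s.filter (fun n : ℕ => ((n : ℕ) : ZMod q) = a)).card : ℝ) ≤ (v - u) / q + 1 := by
  classical
  set T := s.filter (fun n : ℕ => ((n : ℕ) : ZMod q) = a) with hT
  have hq0 : (0 : ℝ) < q := by exact_mod_cast hq
  -- inject `T` into `range (⌊(v - u)/q⌋₊ + 1)` by `n ↦ ⌊(n - u)/q⌋₊`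
  have hmem : ∀ n ∈ T, u ≤ n ∧ (n : ℝ) ≤ v ∧ ((n : ℕ) : ZMod q) = a := fun n hn => by
    rw [hT, Finset.mem_filter] at hn
    exact ⟨(hs n hn.1 hn.2).1, (hs n hn.1 hn.2).2, hn.2⟩
  have hmaps : ∀ n ∈ T, ⌊((n : ℝ) - u) / q⌋₊ ∈ Finset.range (⌊(v - u) / q⌋₊ + 1) := fun n hn => by
    obtain ⟨h1, h2, -⟩ := hmem n hn
    rw [Finset.mem_range, Nat.lt_succ_iff]
    exact Nat.floor_le_floor (div_le_div_of_nonneg_right (by linarith) hq0.le)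
  have hinj : Set.InjOn (fun n : ℕ => ⌊((n : ℝ) - u) / q⌋₊) T := by
    intro n hn n' hn' h
    obtain ⟨h1, -, h3⟩ := hmem n hn
    obtain ⟨h1', -, h3'⟩ := hmem n' hn'
    by_contra hne
    -- two distinct members of the class differ by at least `q`
    have hmodN : n % q = n' % q := by
      have : ((n : ℕ) : ZMod q) = ((n' : ℕ) : ZMod q) := by rw [h3, h3']
      exact (ZMod.natCast_eq_natCast_iff' n n' q).mp this
    have hmod : (n : ℤ) ≡ n' [ZMOD q] := by
      rw [Int.ModEq, ← Int.natCast_mod, ← Int.natCast_mod, hmodN]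
    rcases lt_or_gt_of_ne hne with hlt | hlt
    · have hd : (q : ℤ) ≤ n' - n := by
        have hdvd : (q : ℤ) ∣ n' - n := (Int.ModEq.dvd hmod)
        exact Int.le_of_dvd (by omega) hdvd
      have hd' : (q : ℝ) ≤ (n' : ℝ) - n := by exact_mod_cast hd
      have : ((n : ℝ) - u) / q + 1 ≤ ((n' : ℝ) - u) / q := by
        rw [div_add_one hq0.ne', div_le_div_iff_of_pos_right hq0]; linarith
      have hfl : ⌊((n : ℝ) - u) / q⌋₊ + 1 ≤ ⌊((n' : ℝ) - u) / q⌋₊ := by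
        have := Nat.floor_le_floor this
        rwa [Nat.floor_add_one (div_nonneg (by linarith) hq0.le)] at this
      simp only at h
      omega
    · have hd : (q : ℤ) ≤ n - n' := by
        have hdvd : (q : ℤ) ∣ n - n' := (Int.ModEq.dvd hmod.symm)
        exact Int.le_of_dvd (by omega) hdvd
      have hd' : (q : ℝ) ≤ (n : ℝ) - n' := by exact_mod_cast hd
      have : ((n' : ℝ) - u) / q + 1 ≤ ((n : ℝ) - u) / q := by
        rw [div_add_one hq0.ne', div_le_div_iff_of_pos_right hq0]; linarith
      have hfl : ⌊((n' : ℝ) - u) / q⌋₊ + 1 ≤ ⌊((n : ℝ) - u) / q⌋₊ := by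
        have := Nat.floor_le_floor this
        rwa [Nat.floor_add_one (div_nonneg (by linarith) hq0.le)] at this
      simp only at h
      omega
  have hcard := Finset.card_le_card_of_injOn _ hmaps hinj
  rw [Finset.card_range] at hcard
  have h0 : 0 ≤ (v - u) / q := div_nonneg (by linarith) hq0.le
  calc ((T.card : ℕ) : ℝ) ≤ ((⌊(v - u) / q⌋₊ + 1 : ℕ) : ℝ) := by exact_mod_cast hcard
    _ = (⌊(v - u) / q⌋₊ : ℝ) + 1 := by push_cast; ring
    _ ≤ (v - u) / q + 1 := by linarith [Nat.floor_le h0]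

/-- `(log x)^E ≤ G x^ε` for `x ≥ 1` (`E ≥ 0`, `ε > 0`); a copy of the tree's growth lemma
`BFI.exists_log_rpow_le_rpow` (`BombieriFriedlanderIwaniecPieces.lean`, not imported here). [folklore] -/
theorem exists_log_rpow_le_rpow' {E ε : ℝ} (hE : 0 ≤ E) (hε : 0 < ε) :
    ∃ G : ℝ, 0 < G ∧ ∀ x : ℝ, 1 ≤ x → Real.log x ^ E ≤ G * x ^ ε := by
  rcases eq_or_lt_of_le hE with rfl | hE'
  · refine ⟨1, one_pos, fun x hx => ?_⟩
    rw [Real.rpow_zero, one_mul]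
    exact Real.one_le_rpow hx hε.le
  · set δ : ℝ := ε / E with hδ
    have hδ0 : 0 < δ := by positivity
    refine ⟨δ⁻¹ ^ E, by positivity, fun x hx => ?_⟩
    have hx0 : 0 ≤ x := by linarith
    have hlog : 0 ≤ Real.log x := Real.log_nonneg hx
    have h1 : Real.log x ≤ x ^ δ / δ := Real.log_le_rpow_div hx0 hδ0
    calc Real.log x ^ E ≤ (x ^ δ / δ) ^ E := Real.rpow_le_rpow hlog h1 hE
      _ = δ⁻¹ ^ E * (x ^ δ) ^ E := by
          rw [div_eq_mul_inv, Real.mul_rpow (by positivity) (by positivity), mul_comm]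
      _ = δ⁻¹ ^ E * x ^ ε := by
          rw [← Real.rpow_mul hx0]
          congr 2
          rw [hδ]; field_simp

/-- Real powers of `L ≥ 1/2` compare up to powers of `2`: `L^a ≤ 2^{b−a} L^b` for `a ≤ b`
(used with `L = log x`, `x ≥ 2`). [folklore] -/
theorem rpow_le_two_rpow_mul_rpow {L a b : ℝ} (hL : 1 / 2 ≤ L) (hab : a ≤ b) :
    L ^ a ≤ (2 : ℝ) ^ (b - a) * L ^ b := by
  have hL0 : 0 < L := by linarith
  have h1 : L ^ a = L ^ b * L ^ (a - b) := by
    rw [← Real.rpow_add hL0]; ring_nf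
  have h2 : L ^ (a - b) ≤ (2 : ℝ) ^ (b - a) := by
    rw [show a - b = -(b - a) by ring, Real.rpow_neg hL0.le, ← Real.inv_rpow hL0.le]
    exact Real.rpow_le_rpow (by positivity) (by rw [inv_le_comm₀ hL0 two_pos]; linarith) (by linarith)
  rw [h1, mul_comm]
  exact mul_le_mul_of_nonneg_right h2 (by positivity)

/-- The iterated derivative commutes with the embedding `ℝ → ℂ`. [folklore] -/
theorem iteratedDeriv_ofReal_comp {ψ : ℝ → ℝ} (hψ : ContDiff ℝ ∞ ψ) (i : ℕ) (x : ℝ) :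
    iteratedDeriv i (fun t => (ψ t : ℂ)) x = ((iteratedDeriv i ψ x : ℝ) : ℂ) := by
  have h := ContinuousLinearMap.iteratedFDeriv_comp_left (Complex.ofRealCLM) (f := ψ) (x := x)
    (hψ.contDiffAt) (i := i) (by exact_mod_cast le_top)
  rw [iteratedDeriv, iteratedDeriv, show (fun t => (ψ t : ℂ)) = Complex.ofRealCLM ∘ ψ from rfl, h]
  rfl

/-- A smooth function supported in `[c, C]` has all its derivatives supported in `[c, C]`.
[folklore] -/
theorem iteratedDeriv_eq_zero_of_not_mem {ψ : ℝ → ℝ} {c C : ℝ} (hsupp : ∀ t, ψ t ≠ 0 → c ≤ t ∧ t ≤ C)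
    (i : ℕ) {t : ℝ} (ht : ¬(c ≤ t ∧ t ≤ C)) : iteratedDeriv i ψ t = 0 := by
  have hts : tsupport ψ ⊆ Set.Icc c C :=
    closure_minimal (fun u hu => Set.mem_Icc.mpr (hsupp u hu)) isClosed_Icc
  have ht' : t ∉ tsupport ψ := fun h => ht (Set.mem_Icc.mp (hts h))
  have h0 : iteratedFDeriv ℝ i ψ t = 0 := by
    by_contra hne
    exact ht' (support_iteratedFDeriv_subset i (Function.mem_support.mpr hne))
  rw [iteratedDeriv, h0]
  rfl

/-- **`∫ |(ψ(·/N))''| ≤ N⁻¹ (C − c) M`** for `ψ` smooth, supported in `[c, C]`, `|ψ''| ≤ M`: the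
second-derivative mass of a smooth piece at scale `N` (the quantity `∫|g''|` of
`abs_apDiscrepancy_coprime_smooth_le`). [cite: Polymath8a2014, Lemma 3.4 (iii) (proof, smooth case)] -/
theorem integral_norm_iteratedDeriv_two_scaled_le {ψ : ℝ → ℝ} (hψ : ContDiff ℝ ∞ ψ) {c C : ℝ}
    (hcC : c ≤ C) (hsupp : ∀ t, ψ t ≠ 0 → c ≤ t ∧ t ≤ C) {M : ℝ}
    (hM : ∀ t, |iteratedDeriv 2 ψ t| ≤ M) {N : ℝ} (hN : 0 < N) :
    ∫ y, ‖iteratedDeriv 2 (fun y => (ψ (N⁻¹ * y) : ℂ)) y‖ ≤ N⁻¹ * ((C - c) * M) := by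
  have hM0 : 0 ≤ M := (abs_nonneg _).trans (hM 0)
  -- the derivative of the rescaled function
  have hdiffC : ContDiff ℝ ∞ (fun t => (ψ t : ℂ)) := Complex.ofRealCLM.contDiff.comp hψ
  have hderiv : iteratedDeriv 2 (fun y => (ψ (N⁻¹ * y) : ℂ)) =
      fun y => (N⁻¹) ^ 2 • iteratedDeriv 2 (fun t => (ψ t : ℂ)) (N⁻¹ * y) :=
    iteratedDeriv_comp_const_smul (hdiffC.of_le (WithTop.coe_le_coe.mpr le_top)) N⁻¹
  have hnorm : ∀ y, ‖iteratedDeriv 2 (fun y => (ψ (N⁻¹ * y) : ℂ)) y‖ =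
      (N⁻¹) ^ 2 * |iteratedDeriv 2 ψ (N⁻¹ * y)| := fun y => by
    rw [hderiv]
    simp only [iteratedDeriv_ofReal_comp hψ, norm_smul, Complex.norm_real, Real.norm_eq_abs,
      abs_pow, abs_inv, abs_of_pos hN]
  simp_rw [hnorm]
  rw [MeasureTheory.integral_const_mul,
    MeasureTheory.Measure.integral_comp_mul_left (fun t => |iteratedDeriv 2 ψ t|) N⁻¹, inv_inv,
    abs_of_pos hN, smul_eq_mul]
  -- `∫ |ψ''| ≤ (C - c) M`
  have hbound : ∀ t, |iteratedDeriv 2 ψ t| ≤ Set.indicator (Set.Icc c C) (fun _ => M) t := by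
    intro t
    by_cases ht : c ≤ t ∧ t ≤ C
    · rw [Set.indicator_of_mem (Set.mem_Icc.mpr ht)]; exact hM t
    · rw [iteratedDeriv_eq_zero_of_not_mem hsupp 2 ht, abs_zero]
      exact Set.indicator_nonneg (fun _ _ => hM0) t
  have hint : ∫ t, |iteratedDeriv 2 ψ t| ≤ (C - c) * M := by
    have hcont : Continuous fun t => |iteratedDeriv 2 ψ t| :=
      (hψ.continuous_iteratedDeriv 2 (WithTop.coe_le_coe.mpr le_top)).abs
    have hcs : HasCompactSupport fun t => |iteratedDeriv 2 ψ t| :=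
      HasCompactSupport.intro isCompact_Icc fun t ht => by
        rw [iteratedDeriv_eq_zero_of_not_mem hsupp 2 (fun h => ht (Set.mem_Icc.mpr h)), abs_zero]
    have hI : IntegrableOn (fun _ : ℝ => M) (Set.Icc c C) :=
      integrableOn_const (hs := by rw [Real.volume_Icc]; exact ENNReal.ofReal_ne_top)
        (hC := by simp)
    calc ∫ t, |iteratedDeriv 2 ψ t| ≤ ∫ t, Set.indicator (Set.Icc c C) (fun _ => M) t :=
          MeasureTheory.integral_mono (hcont.integrable_of_hasCompactSupport hcs)
            (hI.integrable_indicator measurableSet_Icc) hbound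
      _ = (C - c) * M := by
          rw [MeasureTheory.integral_indicator measurableSet_Icc, MeasureTheory.setIntegral_const,
            Real.volume_real_Icc_of_le hcC, smul_eq_mul]
  calc (N⁻¹) ^ 2 * (N * ∫ t, |iteratedDeriv 2 ψ t|) = N⁻¹ * ∫ t, |iteratedDeriv 2 ψ t| := by
        field_simp
    _ ≤ N⁻¹ * ((C - c) * M) := mul_le_mul_of_nonneg_left hint (by positivity)

-- a long explicit-constant bookkeeping proof: the default heartbeat budget does not suffice
set_option maxHeartbeats 800000 in
/-- **A smooth sequence at scale `N ≫ x^ε` has the Siegel–Walfisz property** (Polymath 8a,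
Lemma 3.4 (ii)–(iii): "If `N_k ≫ x^ε` for some fixed `ε > 0`, then `α_k` satisfies the Siegel–Walfisz
property" — smooth case), explicit form.  Fix support constants `0 < c ≤ C`, size data
`(K₀, B₀)` for `ψ` and `(K₂, B₂)` for `ψ''`, an exponent `ε > 0` and a target `A`.  Then there is
`Csw ≥ 0` such that for all `x ≥ 2`, all `N` with `x^ε ≤ N` and `cN ≥ 1`, every smooth `ψ` supported
in `[c, C]` with `|ψ| ≤ K₀ (log x)^{B₀}`, `|ψ''| ≤ K₂ (log x)^{B₂}`, every `α` with `α(n) = ψ(n/N)`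
(`n ≥ 1`), all `q, r ≥ 1` and primitive `a (q)`:
`|Δ(α 1_{(·,r)=1}; a (q))| ≤ Csw τ(qr) N (log x)^{-A}` (window `[1, ⌊CN⌋ + 1]`).
Proof: for `q (log x)^{A⁺+B₂} ≤ N` the Poisson bound `abs_apDiscrepancy_coprime_smooth_le`
(`≤ q τ(r) (C+c)(C−c) K₂ (log x)^{B₂}/6`, via `integral_norm_iteratedDeriv_two_scaled_le`); otherwise
the trivial bound `abs_apDiscrepancy_le` with the class count `card_filter_natCast_eq_le` and
`1/φ(q) ≤ τ(q)/q`, the powers of `log x` being paid for by `x^ε ≤ N` (`exists_log_rpow_le_rpow'`).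
[cite: Polymath8a2014, Lemma 3.4 (ii), (iii) (proof, smooth case)] -/
theorem exists_siegelWalfisz_const_of_smooth {c C : ℝ} (hc : 0 < c) (hcC : c ≤ C)
    (K₀ K₂ : ℝ) (B₀ B₂ : ℕ) {ε : ℝ} (hε : 0 < ε) (A : ℝ) :
    ∃ Csw : ℝ, 0 ≤ Csw ∧ ∀ x : ℝ, 2 ≤ x → ∀ N : ℝ, x ^ ε ≤ N → 1 ≤ c * N →
      ∀ ψ : ℝ → ℝ, ContDiff ℝ ∞ ψ → (∀ t, ψ t ≠ 0 → c ≤ t ∧ t ≤ C) →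
      (∀ t, |ψ t| ≤ K₀ * Real.log x ^ B₀) → (∀ t, |iteratedDeriv 2 ψ t| ≤ K₂ * Real.log x ^ B₂) →
      ∀ α : ℕ → ℝ, (∀ n : ℕ, 1 ≤ n → α n = ψ (n / N)) →
      ∀ q : ℕ, 0 < q → ∀ r : ℕ, 0 < r → ∀ a : (ZMod q)ˣ,
        |apDiscrepancy (fun n => if Nat.Coprime n r then α n else 0) (⌊C * N⌋₊ + 1) q a| ≤
          Csw * (σ 0 (q * r) : ℝ) * N / Real.log x ^ A := by
  classical
  set A' : ℝ := max A 0 with hA'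
  have hA'0 : 0 ≤ A' := le_max_right _ _
  have hAA' : A ≤ A' := le_max_left _ _
  set E : ℝ := (B₀ : ℝ) + 2 * A' + B₂ with hE
  obtain ⟨G, hG0, hG⟩ := exists_log_rpow_le_rpow' (E := E) (by positivity) hε
  set K₀' : ℝ := max K₀ 0 with hK₀'
  set K₂' : ℝ := max K₂ 0 with hK₂'
  set K₁ : ℝ := (C + c) * (C - c) * K₂' / 6 with hK₁
  have hCc : 0 ≤ C - c := by linarith
  have hC0 : 0 < C := lt_of_lt_of_le hc hcC
  have hK₁0 : 0 ≤ K₁ := by positivity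
  set Cmax : ℝ := K₁ + K₀' * G * (2 * C + (2 : ℝ) ^ (A' + B₂)) with hCmax
  have hCmax0 : 0 ≤ Cmax := by rw [hCmax]; positivity
  have hK₁Cmax : K₁ ≤ Cmax := by
    rw [hCmax]
    have : 0 ≤ K₀' * G * (2 * C + (2 : ℝ) ^ (A' + B₂)) := by positivity
    linarith
  refine ⟨(2 : ℝ) ^ (A' - A) * Cmax, by positivity, ?_⟩
  clear_value K₁ Cmax
  intro x hx N hNε hcN ψ hψ hsupp h0 h2 α hα q hq r hr a
  haveI : NeZero q := ⟨hq.ne'⟩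
  -- basic positivity
  set L : ℝ := Real.log x with hLdef
  have hL0 : 0 < L := Real.log_pos (by linarith)
  have hLhalf : 1 / 2 ≤ L := by
    have : (1 / 2 : ℝ) ≤ Real.log 2 := by
      have := Real.log_two_gt_d9; norm_num at this ⊢; linarith
    exact this.trans (Real.log_le_log (by norm_num) hx)
  have hN0 : 0 < N := by nlinarith
  have hx1 : 1 ≤ x := by linarith
  have hKL0 : 0 ≤ K₀ * L ^ B₀ := (abs_nonneg _).trans (h0 0)
  have hKL2 : 0 ≤ K₂ * L ^ B₂ := (abs_nonneg _).trans (h2 0)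
  have hK₀le : K₀ ≤ K₀' := le_max_left _ _
  have hK₂le : K₂ ≤ K₂' := le_max_left _ _
  -- the window
  set X : ℕ := ⌊C * N⌋₊ + 1 with hXdef
  have hCN : C * N < X := by rw [hXdef]; push_cast; exact Nat.lt_floor_add_one _
  have hXle : (X : ℝ) ≤ (C + c) * N := by
    rw [hXdef]; push_cast
    have := Nat.floor_le (show 0 ≤ C * N by nlinarith)
    nlinarith
  -- the sequence
  set β : ℕ → ℝ := fun n => if Nat.Coprime n r then α n else 0 with hβ
  have hβα : ∀ n, |β n| ≤ |α n| := fun n => by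
    simp only [hβ]; split_ifs <;> simp
  have hβsupp : ∀ n : ℕ, 1 ≤ n → β n ≠ 0 → c * N ≤ n ∧ (n : ℝ) ≤ C * N := by
    intro n hn hne
    have hαne : α n ≠ 0 := fun h => hne (by
      have := hβα n; rw [h, abs_zero] at this; exact abs_eq_zero.mp (le_antisymm this (abs_nonneg _)))
    rw [hα n hn] at hαne
    obtain ⟨h1, h2⟩ := hsupp _ hαne
    exact ⟨by rwa [le_div_iff₀ hN0] at h1, by rwa [div_le_iff₀ hN0] at h2⟩
  have hβb : ∀ n : ℕ, 1 ≤ n → |β n| ≤ K₀ * L ^ B₀ := fun n hn =>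
    (hβα n).trans (by rw [hα n hn]; exact h0 _)
  ----------------------------------------------------------------
  -- BOUND 1 (Poisson)
  ----------------------------------------------------------------
  set g : ℝ → ℂ := fun y => (ψ (N⁻¹ * y) : ℂ) with hgdef
  have hψ0 : ∀ t, ¬(c ≤ t ∧ t ≤ C) → ψ t = 0 := fun t ht => by
    by_contra hne; exact ht (hsupp t hne)
  have hg : ContDiff ℝ ∞ g :=
    (Complex.ofRealCLM.contDiff.comp hψ).comp (contDiff_const.mul contDiff_id)
  have hconv : ∀ y : ℝ, c ≤ N⁻¹ * y ∧ N⁻¹ * y ≤ C → c * N ≤ y ∧ y ≤ C * N := fun y hy => by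
    rw [inv_mul_eq_div, le_div_iff₀ hN0, div_le_iff₀ hN0] at hy
    exact hy
  have hs : HasCompactSupport g := by
    refine HasCompactSupport.intro (isCompact_Icc (a := c * N) (b := C * N)) fun y hy => ?_
    simp only [hgdef]
    rw [hψ0, Complex.ofReal_zero]
    exact fun h => hy (Set.mem_Icc.mpr (hconv y h))
  have hg₁ : ∀ y : ℝ, y ≤ 1 / 2 → g y = 0 := fun y hy => by
    simp only [hgdef]
    rw [hψ0, Complex.ofReal_zero]
    intro h
    have := (hconv y h).1
    linarith
  have hg₂ : ∀ y : ℝ, (X : ℝ) + 1 / 2 ≤ y → g y = 0 := fun y hy => by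
    simp only [hgdef]
    rw [hψ0, Complex.ofReal_zero]
    intro h
    have := (hconv y h).2
    linarith
  have hαg : ∀ n ∈ Icc 1 X, (α n : ℂ) = g n := fun n hn => by
    simp only [hgdef]
    rw [hα n (Finset.mem_Icc.mp hn).1, inv_mul_eq_div]
  have hB1raw := abs_apDiscrepancy_coprime_smooth_le hg hs hg₁ hg₂ hαg hr.ne' a
  have hI : ∫ y, ‖iteratedDeriv 2 g y‖ ≤ N⁻¹ * ((C - c) * (K₂ * L ^ B₂)) :=
    integral_norm_iteratedDeriv_two_scaled_le hψ hcC hsupp h2 hN0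
  have hsumd : ∑ d ∈ r.divisors with d ≤ X, (d : ℝ) ≤ X * (σ 0 r : ℝ) := by
    have := sum_divisors_filter_le_mul_card r X
    rwa [ArithmeticFunction.sigma_zero_apply]
  have hBOUND1 : |apDiscrepancy β X q a| ≤ (q : ℝ) * (σ 0 r : ℝ) * K₁ * L ^ B₂ := by
    refine hB1raw.trans ?_
    have hq0 : (0 : ℝ) ≤ q := Nat.cast_nonneg q
    calc (q : ℝ) / 6 * (∫ y, ‖iteratedDeriv 2 g y‖) * ∑ d ∈ r.divisors with d ≤ X, (d : ℝ)
        ≤ (q : ℝ) / 6 * (N⁻¹ * ((C - c) * (K₂ * L ^ B₂))) * ((X : ℝ) * (σ 0 r : ℝ)) := by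
          refine mul_le_mul (mul_le_mul_of_nonneg_left hI (by positivity)) hsumd
            (Finset.sum_nonneg fun _ _ => Nat.cast_nonneg _) (by positivity)
      _ ≤ (q : ℝ) / 6 * (N⁻¹ * ((C - c) * (K₂' * L ^ B₂))) * (((C + c) * N) * (σ 0 r : ℝ)) := by
          gcongr
      _ = (q : ℝ) * (σ 0 r : ℝ) * K₁ * L ^ B₂ := by
          rw [hK₁]; field_simp
  ----------------------------------------------------------------
  -- BOUND 2 (trivial)
  ----------------------------------------------------------------
  have hcount : (((Icc 1 X).filter (fun n : ℕ => ((n : ℕ) : ZMod q) = a)).filter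
      (fun n => |β n| ≠ 0)).card ≤ ((C * N - c * N) / q + 1 : ℝ) := by
    have hset : ((Icc 1 X).filter (fun n : ℕ => ((n : ℕ) : ZMod q) = a)).filter (fun n => |β n| ≠ 0)
        = ((Icc 1 X).filter (fun n => |β n| ≠ 0)).filter (fun n : ℕ => ((n : ℕ) : ZMod q) = a) := by
      rw [Finset.filter_filter, Finset.filter_filter]
      exact Finset.filter_congr fun n _ => and_comm
    rw [hset]
    refine card_filter_natCast_eq_le hq (a : ZMod q) _ (by nlinarith) fun n hn _ => ?_
    rw [Finset.mem_filter, Finset.mem_Icc] at hn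
    exact hβsupp n hn.1.1 (abs_ne_zero.mp hn.2)
  have hfirst : ∑ n ∈ (Icc 1 X).filter (fun n : ℕ => ((n : ℕ) : ZMod q) = a), |β n| ≤
      K₀ * L ^ B₀ * ((C * N - c * N) / q + 1) := by
    rw [← Finset.sum_filter_ne_zero]
    calc ∑ n ∈ ((Icc 1 X).filter (fun n : ℕ => ((n : ℕ) : ZMod q) = a)).filter (fun n => |β n| ≠ 0),
          |β n|
        ≤ ∑ n ∈ ((Icc 1 X).filter (fun n : ℕ => ((n : ℕ) : ZMod q) = a)).filter (fun n => |β n| ≠ 0),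
          K₀ * L ^ B₀ := Finset.sum_le_sum fun n hn => by
            have h1 := (Finset.mem_Icc.mp (Finset.mem_filter.mp (Finset.mem_filter.mp hn).1).1).1
            exact hβb n h1
      _ = _ * (K₀ * L ^ B₀) := by rw [Finset.sum_const, nsmul_eq_mul]
      _ ≤ ((C * N - c * N) / q + 1) * (K₀ * L ^ B₀) := mul_le_mul_of_nonneg_right hcount hKL0
      _ = K₀ * L ^ B₀ * ((C * N - c * N) / q + 1) := mul_comm _ _
  have hsecond : ∑ n ∈ Icc 1 X, |β n| ≤ K₀ * L ^ B₀ * ((C + c) * N) := by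
    calc ∑ n ∈ Icc 1 X, |β n| ≤ ∑ n ∈ Icc 1 X, K₀ * L ^ B₀ :=
          Finset.sum_le_sum fun n hn => hβb n (Finset.mem_Icc.mp hn).1
      _ = X * (K₀ * L ^ B₀) := by rw [Finset.sum_const, Nat.card_Icc, nsmul_eq_mul]; simp
      _ ≤ ((C + c) * N) * (K₀ * L ^ B₀) := mul_le_mul_of_nonneg_right hXle hKL0
      _ = K₀ * L ^ B₀ * ((C + c) * N) := mul_comm _ _
  have hφ : ((Nat.totient q : ℝ))⁻¹ ≤ (σ 0 q : ℝ) / q := inv_totient_le_sigma_zero_div q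
  have hBOUND2 : |apDiscrepancy β X q a| ≤
      K₀ * L ^ B₀ * ((C - c) * N / q + 1) + K₀ * L ^ B₀ * ((C + c) * N) * ((σ 0 q : ℝ) / q) := by
    refine (abs_apDiscrepancy_le β X q a).trans (add_le_add (by
      have := hfirst; rwa [show C * N - c * N = (C - c) * N by ring] at this) ?_)
    rw [div_eq_mul_inv]
    exact mul_le_mul hsecond hφ (by positivity) (by positivity)
  ----------------------------------------------------------------
  -- COMBINE
  ----------------------------------------------------------------
  -- divisor functions
  have hqr0 : q * r ≠ 0 := Nat.mul_ne_zero hq.ne' hr.ne'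
  have hτr : (σ 0 r : ℝ) ≤ (σ 0 (q * r) : ℝ) := by
    exact_mod_cast sigma_zero_le_of_dvd hqr0 (dvd_mul_left r q)
  have hτq : (σ 0 q : ℝ) ≤ (σ 0 (q * r) : ℝ) := by
    exact_mod_cast sigma_zero_le_of_dvd hqr0 (dvd_mul_right q r)
  have hτq1 : (1 : ℝ) ≤ (σ 0 q : ℝ) := by exact_mod_cast one_le_sigma_zero hq.ne'
  set T : ℝ := (σ 0 (q * r) : ℝ) with hT
  have hT1 : 1 ≤ T := hτq1.trans hτq
  have hT0 : 0 ≤ T := le_trans zero_le_one hT1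
  -- rpow bookkeeping
  have hLB₂ : (L ^ B₂ : ℝ) = L ^ (A' + B₂) * L ^ (-A') := by
    rw [← Real.rpow_natCast, ← Real.rpow_add hL0]; ring_nf
  have hLE : L ^ ((B₀ : ℝ) + (A' + B₂)) = L ^ E * L ^ (-A') := by
    rw [← Real.rpow_add hL0, hE]; ring_nf
  have hGN : L ^ E ≤ G * N := (hG x hx1).trans (mul_le_mul_of_nonneg_left hNε hG0.le)
  have hmain : |apDiscrepancy β X q a| ≤ Cmax * T * N * L ^ (-A') := by
    by_cases hcase : (q : ℝ) * L ^ (A' + B₂) ≤ N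
    · -- Poisson range
      refine hBOUND1.trans ?_
      have hLA0 : 0 ≤ L ^ (-A') := Real.rpow_nonneg hL0.le _
      have hσr0 : 0 ≤ (σ 0 r : ℝ) := Nat.cast_nonneg _
      calc (q : ℝ) * (σ 0 r : ℝ) * K₁ * L ^ B₂
          = K₁ * (σ 0 r : ℝ) * ((q : ℝ) * L ^ (A' + B₂)) * L ^ (-A') := by rw [hLB₂]; ring
        _ ≤ K₁ * T * N * L ^ (-A') :=
            mul_le_mul_of_nonneg_right (mul_le_mul (mul_le_mul_of_nonneg_left hτr hK₁0) hcase
              (by positivity) (mul_nonneg hK₁0 hT0)) hLA0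
        _ ≤ Cmax * T * N * L ^ (-A') :=
            mul_le_mul_of_nonneg_right (mul_le_mul_of_nonneg_right
              (mul_le_mul_of_nonneg_right hK₁Cmax hT0) hN0.le) hLA0
    · -- trivial range: `N / q < L^{A'+B₂}`
      push Not at hcase
      have hq0 : (0 : ℝ) < q := by exact_mod_cast hq
      have hNq : N / q ≤ L ^ (A' + B₂) := by
        rw [div_le_iff₀ hq0]; linarith
      refine hBOUND2.trans ?_
      -- term (a): `K₀ L^{B₀} (C-c) N/q ≤ K₀' (C-c) L^E L^{-A'}`
      have hB₀pow : (L ^ B₀ : ℝ) = L ^ (B₀ : ℝ) := (Real.rpow_natCast L B₀).symm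
      have hLA0 : 0 ≤ L ^ (-A') := Real.rpow_nonneg hL0.le _
      have hK₀'0 : 0 ≤ K₀' := le_max_right _ _
      have hK₀L : K₀ * L ^ B₀ ≤ K₀' * L ^ B₀ := mul_le_mul_of_nonneg_right hK₀le (pow_nonneg hL0.le _)
      have hK₀'L : 0 ≤ K₀' * L ^ B₀ := mul_nonneg hK₀'0 (pow_nonneg hL0.le _)
      have hEN : L ^ E * L ^ (-A') ≤ G * N * L ^ (-A') := mul_le_mul_of_nonneg_right hGN hLA0
      have ha : K₀ * L ^ B₀ * ((C - c) * N / q) ≤ K₀' * (C - c) * (G * N) * L ^ (-A') := by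
        calc K₀ * L ^ B₀ * ((C - c) * N / q) = (K₀ * L ^ B₀) * (C - c) * (N / q) := by ring
          _ ≤ (K₀' * L ^ B₀) * (C - c) * L ^ (A' + B₂) :=
              mul_le_mul (mul_le_mul_of_nonneg_right hK₀L hCc) hNq (by positivity)
                (mul_nonneg hK₀'L hCc)
          _ = K₀' * (C - c) * (L ^ (B₀ : ℝ) * L ^ (A' + B₂)) := by rw [hB₀pow]; ring
          _ = K₀' * (C - c) * (L ^ E * L ^ (-A')) := by rw [← Real.rpow_add hL0, hLE]
          _ ≤ K₀' * (C - c) * (G * N * L ^ (-A')) :=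
              mul_le_mul_of_nonneg_left hEN (mul_nonneg hK₀'0 hCc)
          _ = K₀' * (C - c) * (G * N) * L ^ (-A') := by ring
      -- term (b): `K₀ L^{B₀} ≤ K₀' 2^{A'+B₂} L^E L^{-A'}`
      have hb : K₀ * L ^ B₀ * 1 ≤ K₀' * (2 : ℝ) ^ (A' + B₂) * (G * N) * L ^ (-A') := by
        have h1 : L ^ (B₀ : ℝ) ≤ (2 : ℝ) ^ (A' + B₂) * L ^ ((B₀ : ℝ) + (A' + B₂)) := by
          have := rpow_le_two_rpow_mul_rpow hLhalf (show (B₀ : ℝ) ≤ B₀ + (A' + B₂) by linarith)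
          rwa [show (B₀ : ℝ) + (A' + B₂) - B₀ = A' + B₂ by ring] at this
        calc K₀ * L ^ B₀ * 1 = K₀ * L ^ B₀ := mul_one _
          _ ≤ K₀' * L ^ (B₀ : ℝ) := by rw [← hB₀pow]; exact hK₀L
          _ ≤ K₀' * ((2 : ℝ) ^ (A' + B₂) * L ^ ((B₀ : ℝ) + (A' + B₂))) :=
              mul_le_mul_of_nonneg_left h1 hK₀'0
          _ = K₀' * (2 : ℝ) ^ (A' + B₂) * (L ^ E * L ^ (-A')) := by rw [hLE]; ring
          _ ≤ K₀' * (2 : ℝ) ^ (A' + B₂) * (G * N * L ^ (-A')) :=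
              mul_le_mul_of_nonneg_left hEN (mul_nonneg hK₀'0 (Real.rpow_nonneg (by norm_num) _))
          _ = K₀' * (2 : ℝ) ^ (A' + B₂) * (G * N) * L ^ (-A') := by ring
      -- term (c): `K₀ L^{B₀} (C+c) N τ(q)/q ≤ K₀' (C+c) τ(q) L^E L^{-A'}`
      have hCc' : 0 ≤ C + c := by linarith
      have hc' : K₀ * L ^ B₀ * ((C + c) * N) * ((σ 0 q : ℝ) / q) ≤
          K₀' * (C + c) * T * (G * N) * L ^ (-A') := by
        calc K₀ * L ^ B₀ * ((C + c) * N) * ((σ 0 q : ℝ) / q)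
            = (K₀ * L ^ B₀) * (C + c) * (σ 0 q : ℝ) * (N / q) := by ring
          _ ≤ (K₀' * L ^ B₀) * (C + c) * T * L ^ (A' + B₂) :=
              mul_le_mul (mul_le_mul (mul_le_mul_of_nonneg_right hK₀L hCc') hτq
                (Nat.cast_nonneg _) (mul_nonneg hK₀'L hCc')) hNq (by positivity)
                (mul_nonneg (mul_nonneg hK₀'L hCc') (by positivity))
          _ = K₀' * (C + c) * T * (L ^ (B₀ : ℝ) * L ^ (A' + B₂)) := by rw [hB₀pow]; ring
          _ = K₀' * (C + c) * T * (L ^ E * L ^ (-A')) := by rw [← Real.rpow_add hL0, hLE]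
          _ ≤ K₀' * (C + c) * T * (G * N * L ^ (-A')) :=
              mul_le_mul_of_nonneg_left hEN (by positivity)
          _ = K₀' * (C + c) * T * (G * N) * L ^ (-A') := by ring
      have hsum : K₀ * L ^ B₀ * ((C - c) * N / q + 1) + K₀ * L ^ B₀ * ((C + c) * N) * ((σ 0 q : ℝ) / q)
          ≤ (K₀' * (C - c) + K₀' * (2 : ℝ) ^ (A' + B₂) + K₀' * (C + c) * T) * (G * N) * L ^ (-A') := by
        have := add_le_add (add_le_add ha hb) hc'
        calc _ = K₀ * L ^ B₀ * ((C - c) * N / q) + K₀ * L ^ B₀ * 1 +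
              K₀ * L ^ B₀ * ((C + c) * N) * ((σ 0 q : ℝ) / q) := by ring
          _ ≤ _ := this
          _ = _ := by ring
      refine hsum.trans ?_
      have hcoef : (K₀' * (C - c) + K₀' * (2 : ℝ) ^ (A' + B₂) + K₀' * (C + c) * T) * (G * N) ≤
          Cmax * T * N := by
        have h1 : K₀' * (C - c) ≤ K₀' * (C - c) * T :=
          le_mul_of_one_le_right (mul_nonneg hK₀'0 hCc) hT1
        have h2 : K₀' * (2 : ℝ) ^ (A' + B₂) ≤ K₀' * (2 : ℝ) ^ (A' + B₂) * T :=
          le_mul_of_one_le_right (by positivity) hT1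
        have hsum3 : K₀' * (C - c) + K₀' * (2 : ℝ) ^ (A' + B₂) + K₀' * (C + c) * T ≤
            (K₀' * (2 * C + (2 : ℝ) ^ (A' + B₂))) * T := by
          have e : (K₀' * (2 * C + (2 : ℝ) ^ (A' + B₂))) * T =
              K₀' * (C - c) * T + K₀' * (2 : ℝ) ^ (A' + B₂) * T + K₀' * (C + c) * T := by ring
          rw [e]; linarith
        calc (K₀' * (C - c) + K₀' * (2 : ℝ) ^ (A' + B₂) + K₀' * (C + c) * T) * (G * N)
            ≤ (K₀' * (2 * C + (2 : ℝ) ^ (A' + B₂))) * T * (G * N) :=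
              mul_le_mul_of_nonneg_right hsum3 (by positivity)
          _ = (K₀' * G * (2 * C + (2 : ℝ) ^ (A' + B₂))) * T * N := by ring
          _ ≤ Cmax * T * N := by
              have : K₀' * G * (2 * C + (2 : ℝ) ^ (A' + B₂)) ≤ Cmax := by rw [hCmax]; linarith
              exact mul_le_mul_of_nonneg_right (mul_le_mul_of_nonneg_right this hT0) hN0.le
      exact mul_le_mul_of_nonneg_right hcoef (by positivity)
  -- from `L^{-A'}` to `L^{-A}`
  have hAconv : L ^ (-A') ≤ (2 : ℝ) ^ (A' - A) * L ^ (-A) := by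
    have := rpow_le_two_rpow_mul_rpow hLhalf (show -A' ≤ -A by linarith)
    rwa [show -A - -A' = A' - A by ring] at this
  calc |apDiscrepancy β X q a| ≤ Cmax * T * N * L ^ (-A') := hmain
    _ ≤ Cmax * T * N * ((2 : ℝ) ^ (A' - A) * L ^ (-A)) :=
        mul_le_mul_of_nonneg_left hAconv (mul_nonneg (mul_nonneg hCmax0 hT0) hN0.le)
    _ = (2 : ℝ) ^ (A' - A) * Cmax * T * N / L ^ A := by
        rw [Real.rpow_neg hL0.le, div_eq_mul_inv]; ring

end Polymath8a

end Literature.NumberTheory.Sieve
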